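import Literature.MathematicalPhysics.QuantumFieldTheory.Balaban1983to89.B9SectCDiffCutModelToy2

/-!
# `Balaban1983to89.B9SectCDiffCutModelToy3` — the FIRST INHABITED `CutModel`, `LDat` and `EstHyp`: a complete cut
model on the one-level toy with a DEGENERATE differential block (∂ = 0, Λ = Λ′ = 1, A = A′ = 0) and the zero Leibniz
block, the (L) bundle at `θ = 4/M` via `CutModel.toLDat`, the (M) bundles at `c = B⁴` and the two profiles (P) of a
toy frame, and THEOREM D's pipeline `assemble` / `core_diff_entry_of_parts` run END TO END on this instance
(item (a‴) of the census `b2b-balaban-r1/SectC-inst-census.md` §6, v1.4)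

B9 = T. Bałaban, *Propagators for lattice gauge theories in a background field*, Commun. Math. Phys. **99**, 389–434
(1985) [Balaban1985BackgroundPropagators].

CITATION HEADER (lean-in-tree rule 2026-08-18).  Cell `pub-balaban`, unit `b2b-balaban-r1-g15` (READER GROUP A,
lineage r1, gen 15), journal claim `SECTC-DIFF-CUTMODEL-TOY3`.  Source: doi:10.1007/bf01240355, held
`paper:balaban1985-cmp99-background-propagators`, journal page = PDF page + 388.  This unit re-read NO page and
introduces NO quotation: the sentences the cut model makes quantitative are quoted VERBATIM in
`…B9SectCDiffCutModel`'s header (p. 408 [PDF 20] the partition of unity; p. 412 [PDF 24] *"… the operators may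
differ outside □̃₀ …"*; p. 413 [PDF 25] (3.100); p. 414 [PDF 26] (3.102) and the «O(M⁻¹)» sentence), the operators
(3.25)–(3.27) (pp. 394–395 [PDF 6–7]) in `…B9SectCDiff`'s and `…B9SectCDiffExpansion`'s headers, the block
averaging (3.19) (p. 393 [PDF 5]) in `…B9Eq319Avg`'s header, and the inequalities (3.42) (p. 397 [PDF 9]), (3.48)
(Theorem 3.2, p. 398 [PDF 10]) and the operator `E = Q′G′²Q′*` of (3.97) (p. 412 [PDF 24]) in `…B9SectCDiffDict`'s,
`…B9SectCDiffEstimate`'s and `…B9SectCDiffAssembly`'s headers; the page tags on the declarations below point to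
those quotations BY NAME and are copied from the tagged tree declarations they instantiate (`MOne`, `MTwo`,
`assemble`, `core_diff_entry_of_parts`, `CutModel`).  Tree inputs (by name): `B9SectCDiffExpansion.TwoSeq`
(+ `TwoSeq.T₁`, `T₂`, `dΛ`, `dDt`, `ddA'`, `dA'₁`, `dA'₂`, `dQ'`), `B9SectCDiffAssembly.{MOne, MTwo, LDat, LDat.zQ',
assemble, core_diff_entry_of_parts}`, `B9SectCDiffCutModel.{OpConst, OpLoc, CutModel, CutModel.theta, CutModel.psum,
CutModel.toLDat}`, `B9SectCDiffEstimate.{Frame, Frame.Valid, Frame.rate, Frame.rate_zero, Frame.σ, OpDec, OpZon,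
BlkMaj, WDec, RowZone, EstHyp, EstHyp.c, EstHyp.θ}`, `B9SectCDiff.{tdef, cutX, tdef_one}`, `B6DomainChange.{Profile,
IsDepth}`, `B6DomainMajorant.{zoneDepth, isDepth_zoneDepth}`, `B4Sect5Torus.IsPseudoDist`,
`B9SectCDiffCutModelToy.{dE, pos, pos_xS, bdist, bdist_isPseudoDist, bdist_nonneg, bdist_self, ramp,
ramp_eq_one_of_ge, hcut, lineFrame, lineFrame_valid, rampZone, rampZone_nonempty, ramp_modulus, ramp_zone, Qp, xS,
Qp_rowsum, opLoc_Qp, Win}`, `B9SectCDiffCutModelToy2.{hcut_xS_eq_zero_of_le, Qalt, Qalt_of_lt, Qalt_of_not_lt,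
Qalt_rowsum, Qalt_agree, opLoc_Qalt, instDecidableEqWin, Lft, S2, p2, xS2, bs2, bs2_eq_inl_iff, bs2_eq_inr_iff,
filter_bs2_inl, filter_bs2_inr, Q2, Qpt, Q2t, Q2_inl, Q2_inr, Q2t_inl, Q2t_inr, farS1, farS2, locQp1, locQ2t, opLoc_Q2,
opLoc_Q2t}`.  Cell rows: GAPS C-r1g13-1 (the cut model), C-r1g14-1 / C-r1g15-1 (the toys), this module's row
C-r1g15-2; census `b2b-balaban-r1/SectC-inst-census.md` §3/§5/§6(a‴).  Mathlib otherwise.  No `HarnessLib` fact,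
no named-fact `Prop`, no hypothesis structure introduced; no `sorry`.

## WHAT THIS MODULE DOES

Gen 13's `CutModel F X …` (76 fields — 29 data, 47 hypotheses — over a two-sequence system `X : TwoSeq`) and gen
11/12's `EstHyp F X t U₁ U₂` (40 fields: (M), (L), (P)) had NO inhabitant; gens 14–15 inhabited their geometric and
two-sequence hypothesis SHAPES one by one on the one-level block line.  This leaf closes the loop on the toy:
* §0 **`toyFrame n B N hN δ₀ : Frame (Fin n)`** — `lineFrame`'s data (`ρ = |I − J|`, `β = zoneDepth ρ N`, `sc ≡ B`,
  `δ₀`, `u = δ₀/20`, `Λ = 1`) with the constant profile `K ≡ n·(B+1)` (`lineFrame`'s `K ≡ 1` admits no `Profile`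
  for `n ≥ 2`); `toyFrame_valid`; `opLoc_toy` (an h-free record in `lineFrame` is one in `toyFrame`: records read
  only `ρ, β, sc, δ₀`); the two profiles `toyFrame_profile₁` (`Σ_J e^{−a|I−J|} ≤ n`) and `toyFrame_profile₂`
  (`≤ |Win ⊕ Lft| ≤ n + nB`);
* §1 generic zero records: the zero matrix has an h-free record with constants `r = c = 0` (`opLoc_zero`), lies in
  every zone class `𝒵(k, 0)` (`opZon_zero`) and in every class `𝒟(m, k, c)`, `c ≥ 0`, of the toy frame
  (`opDec_zero_toy`);
* §2 the inverse identities of the toy's Q-type operators: `Q′·Q′*₁ = 1` on `Fin n` (`mul_Qpt_eq_one`, from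
  non-negativity + unit block row sums; `Qp_mul_Qpt`, `Qalt_mul_Qpt`) and `Q2 W·Q′*₂ = 1` on `S2 = Win ⊕ Lft`
  (`Q2_mul_Q2t_eq_one`: a left un-averaged site meets no window block; `Q2Qp_mul_Q2t`, `Q2Qalt_mul_Q2t`);
* §3 **`toyX : TwoSeq (Fin n × Fin B) (Fin n × Fin B) (Fin n) (S2 n B I₀) (Fin n) (S2 n B I₀)`** — shared fine
  carriers sites = bonds = `Fin n × Fin B`, coarse carriers `Fin n` (sequence 1) and `S2` (sequence 2); cutoffs
  `χ = diag h`, `ψ = cutX val inl (h∘x_S)`; ∂ = ∂* = 0, Λ = Λ′ = 1, A = A′ = 0; Q₁ = Q′₁ = `Qp`, Q₂ = `Q2 Qp`,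
  Q′₂ = `Q2 Qalt` (sequence 2 DIFFERS from sequence 1 off the cutoff support and lives on another carrier),
  adjoint-type `Qpt`/`Q2t`; G′ = G = C = 1 — the six inverse identities behind (3.25)–(3.27) HOLD (by §2), so
  this is a genuine `TwoSeq` (no hypothesis left open); `toyX_Q'_ne`: the two scalar averagings differ;
* §4 **`toyCut : CutModel (toyFrame n B (rampZone n M I₀) _ δ₀) toyX id p2 fst fst id id bs2 bs2 bs2 id id 0
  (Fin n × Fin B) (Win n I₀) (Win n I₀)`** — ALL 76 fields discharged: cut geometry (`dE`, ramp `h`, radius `B`,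
  `ω₀ = 1/M`, windows `val`/`inl`), presentations (`rfl`), the three cutoff facts (`ramp_modulus`, `ramp_zone`,
  `farS1`/`farS2`), support-only agreement (`Qalt_agree` for Q′; `rfl` for Q, Q*, Q′*, A), the seven h-free records
  (`opLoc_Q2 (opLoc_Qp)`, `opLoc_Q2t`, three `opLoc_zero`, `opLoc_Q2 (opLoc_Qalt)`, `opLoc_Q2t`, moved to the toy
  frame by `opLoc_toy`), the four all-row/column localities, and the Leibniz block with ZERO coefficient operators
  (`𝔇(Λ) = 𝔇(1) = 0`, `∂·𝔇(∂*) = 0`, `𝔇(Δ′_a) = 𝔇(1) = 0` by `tdef_one`; classes by `opZon_zero`); its common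
  constant is `toyCut_theta : toyCut.theta = 4/M` (`ω₀·Σ r_T c_T + θL = (1/M)·(1+1+0+0+0+1+1) + 0`);
* §5 **`toyLDat := toyCut.toLDat (toyFrame_valid …) : LDat … toyCut.theta`** and
  `ldat_nonempty : Nonempty (LDat (toyFrame …) toyX id p2 fst fst id id bs2 bs2 bs2 id id 0 (4 / M))` — the
  FIRST INHABITED (L) bundle: the seven zone fields `zQ … zQ't` of THEOREM D's hypothesis record hold for a concrete
  two-sequence system by the gen-13 pipeline `opZon_of_geom` ×7 + `opZon_mono`, not by fiat;
* §6 **(M) on the toy at `c = B⁴`** with IDENTITY block majorants: `blkMaj_one`/`wdec_one_toy`/`opDec_one_toy`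
  (`1 ∈ 𝒟(0, k, c)` iff-type condition `1 ≤ c·B^k`), `blkMaj_of_rowsum`/`opDec_of_rowsum` (Q′, Qalt),
  `blkMaj_Qpt`/`opDec_Qpt`, `blkMaj_Q2t`/`opDec_Q2t`, `blkMaj_Q2`/`opDec_Q2` (the window/left-site case analysis),
  `B4_weights` (`1 ≤ B⁴`, `1 ≤ B⁴·B²`, `1 ≤ B⁴·B⁻⁴` — the class `𝒟(0, −4)` of `C = 1` forces `c = B⁴`), hence
  **`toyMOne : MOne (toyFrame …) toyX id fst fst id id (B⁴)`** (7 fields) and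
  **`toyMTwo : MTwo (toyFrame …) toyX p2 bs2 bs2 bs2 id id 0 (B⁴)`** (9 fields, `∇ = 0`);
* §7 **`toyEstHyp := assemble (toyFrame_valid …) toyMOne toyMTwo toyLDat … toyFrame_profile₁ toyFrame_profile₂ :
  EstHyp (toyFrame …) toyX (Fin n × Fin B) (Fin n) (S2 n B I₀)`**, `estHyp_nonempty`, `toyEstHyp_c : _.c = B⁴`,
  `toyEstHyp_θ : _.θ = 4/M` — the FIRST INHABITED 40-field hypothesis record of THEOREM D; and
  **`toy_core_diff_entry`** = the cell's `core_diff_entry_of_parts` INSTANTIATED: at window blocks `u, u′` with full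
  cutoff, `|T₁(u, u′) − T₂(inl u, inl u′)| ≤ 22·(4/M)·(max 1 (max B⁴ B⁴)·Λ·K(u))¹⁵·sc(u)²·e^{−σ(ρ(u,u′)+β(u)+β(u′))}`
  for the two minimal-propagator-type operators `T = QGQ*` on the two coarse carriers — every one of the pipeline's
  hypotheses (`Frame.Valid`, (M)×2, (L), `0 < c`, `0 ≤ θ`, (P)×2, injective windows, `ψ = cutX …`, `ψ = 1` at the
  two rows) DISCHARGED on an instance; `toy_T_diff_eq_zero` records that the left side vanishes here (T₁ = T₂ = 1).

## WHAT IS NOT CLAIMED (ABSOLUTE RULE)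

Nothing printed is asserted.  This is a TOY and the differential block is DEGENERATE (∂ = 0: no lattice calculus,
no Leibniz rule content — census D2 untouched; the Leibniz identities hold here only because both sides vanish).
The (M) classes are witnessed by IDENTITY majorants with the `B`-dependent constant `c = B⁴`, and the profile
`K ≡ n·(B+1)` depends on the volume `n` BY DESIGN — uniformity in the volume, which is the entire content of the
printed estimates (3.42)/(3.48)/(1.12), is NOT modelled; the instantiated bound `toy_core_diff_entry` is numerically
void (its left side is 0, `toy_T_diff_eq_zero`) and says NOTHING about B9's operators.  Value = the kernel
certificate that the 76-field `CutModel` and the 40-field `EstHyp` are CONSISTENT (jointly satisfiable with a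
non-constant cutoff, two different sequences on two coarse carriers, ω₀ = 1/M, live localities and zone facts) and
that `CutModel.toLDat`, `assemble` and `core_diff_entry_of_parts` run end to end on an instance with constants
`θ = 4/M`, `c = B⁴` computed, not postulated — NOT summit progress.
-/

namespace Literature.MathematicalPhysics.QuantumFieldTheory.Balaban1983to89.B9SectCDiffCutModelToy3

open Finset Real
open B4Sect5Torus (IsPseudoDist)
open B6DomainChange (IsDepth Profile)
open B6DomainMajorant (zoneDepth isDepth_zoneDepth)
open B9SectCDiffEstimate
open B9SectCDiffAssembly
open B9SectCDiffExpansion (TwoSeq)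
open B9SectCDiffCutModel
open B9SectCDiffCutModelToy
open B9SectCDiffCutModelToy2
open B9SectCDiff (tdef cutX)

noncomputable section

/-! ## §0 The toy frame with a summation profile -/

section ToyFrame

variable {n B : ℕ}

/-- **THE TOY FRAME**: the block frame of the one-level line (`ρ(I, J) = |I − J|`, depth `zoneDepth ρ N`, proper
scale `sc ≡ B`, rate `δ₀`, unit loss `u = δ₀/20`, `Λ = 1` — all as in `lineFrame`) with the CONSTANT summation
profile `K ≡ n·(B + 1)` (the number of coarse elements of either sequence bounds every profile sum; uniformity in
`n` is not the point of the toy).  OURS (typing). [folklore] -/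
noncomputable def toyFrame (n B : ℕ) (N : Finset (Fin n)) (hN : N.Nonempty) (δ₀ : ℝ) : Frame (Fin n) where
  ρ := bdist n
  β := zoneDepth (bdist n) N hN
  K := fun _ => (n : ℝ) * (B + 1)
  sc := fun _ => (B : ℝ)
  δ₀ := δ₀
  u := δ₀ / 20
  Λ := 1

variable {N : Finset (Fin n)} {hN : N.Nonempty} {δ₀ : ℝ}

/-- [folklore] -/ @[simp] theorem toyFrame_ρ : (toyFrame n B N hN δ₀).ρ = bdist n := rfl
/-- [folklore] -/ @[simp] theorem toyFrame_β : (toyFrame n B N hN δ₀).β = zoneDepth (bdist n) N hN := rfl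
/-- [folklore] -/ @[simp] theorem toyFrame_sc (I : Fin n) : (toyFrame n B N hN δ₀).sc I = (B : ℝ) := rfl
/-- [folklore] -/ @[simp] theorem toyFrame_δ₀ : (toyFrame n B N hN δ₀).δ₀ = δ₀ := rfl
/-- [folklore] -/ @[simp] theorem toyFrame_K (a : ℝ) : (toyFrame n B N hN δ₀).K a = (n : ℝ) * (B + 1) := rfl
/-- [folklore] -/ @[simp] theorem toyFrame_u : (toyFrame n B N hN δ₀).u = δ₀ / 20 := rfl
/-- [folklore] -/ @[simp] theorem toyFrame_Λ : (toyFrame n B N hN δ₀).Λ = 1 := rfl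

/-- the toy frame is valid for `0 < B`, `0 < δ₀` (the line is non-empty since the zone is). [folklore] -/
theorem toyFrame_valid (hB : 0 < B) (hN : N.Nonempty) (hδ₀ : 0 < δ₀) : (toyFrame n B N hN δ₀).Valid where
  hρ := bdist_isPseudoDist n
  hβ := isDepth_zoneDepth (bdist_isPseudoDist n) N hN
  hK a _ := by show (0 : ℝ) ≤ n * (B + 1); positivity
  hsc I := by show (0 : ℝ) < B; exact_mod_cast hB
  htr k hk hk' := (lineFrame_valid hB hN hδ₀).htr k hk hk'
  hu := by show 0 < δ₀ / 20; linarith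
  hΛ := le_refl _
  hKu := by
    show (1 : ℝ) ≤ n * (B + 1)
    have hn : (1 : ℝ) ≤ n := by exact_mod_cast hN.choose.pos
    have hB' : (1 : ℝ) ≤ B + 1 := by linarith [(Nat.cast_nonneg B : (0 : ℝ) ≤ B)]
    nlinarith
  hδ₀ := by show 20 * (δ₀ / 20) ≤ δ₀; linarith

/-- an h-free record in the block frame `lineFrame` is one in `toyFrame` (the record reads only `ρ, β, sc, δ₀`).
[folklore] -/
theorem opLoc_toy {U₁ U₂ E u v mu : Type*} [Fintype v] [DecidableEq U₂] {p₁ : U₁ → Fin n} {p₂ : U₂ → Fin n}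
    {dE : E → E → ℝ} {ℓ : E → ℝ} {k : ℤ} {o : OpConst} {T : Matrix u v ℝ} {f : mu → u} {xr : mu → E}
    {xc : v → E} {br : mu → U₁} {bc : v → U₂} (h : OpLoc (lineFrame n B N hN δ₀) p₁ p₂ dE ℓ k o T f xr xc br bc) :
    OpLoc (toyFrame n B N hN δ₀) p₁ p₂ dE ℓ k o T f xr xc br bc where
  r_nonneg := h.r_nonneg
  c_nonneg := h.c_nonneg
  rng := h.rng
  loc := h.loc
  maj := h.maj

/-- **PROFILE of sequence 1** (coarse elements = blocks): `Σ_J e^{−a|I−J|} ≤ n ≤ K`. [folklore] -/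
theorem toyFrame_profile₁ : Profile (toyFrame n B N hN δ₀).ρ id (toyFrame n B N hN δ₀).K := by
  intro a ha s
  show ∑ j : Fin n, Real.exp (-(a * bdist n s (id j))) ≤ (n : ℝ) * (B + 1)
  calc ∑ j : Fin n, Real.exp (-(a * bdist n s (id j))) ≤ ∑ _j : Fin n, (1 : ℝ) :=
        sum_le_sum fun j _ => Real.exp_le_one_iff.2 (neg_nonpos.2 (mul_nonneg ha.le (bdist_nonneg _ _)))
    _ = n := by simp
    _ ≤ n * (B + 1) := le_mul_of_one_le_right (Nat.cast_nonneg n) (by linarith [(Nat.cast_nonneg B : (0 : ℝ) ≤ B)])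

/-- **PROFILE of sequence 2** (coarse elements = window blocks ⊕ left sites): `≤ |S2| ≤ n + nB = K`. [folklore] -/
theorem toyFrame_profile₂ {I₀ : ℕ} : Profile (toyFrame n B N hN δ₀).ρ (p2 n B I₀) (toyFrame n B N hN δ₀).K := by
  intro a ha s
  show ∑ j : S2 n B I₀, Real.exp (-(a * bdist n s (p2 n B I₀ j))) ≤ (n : ℝ) * (B + 1)
  have h1 : Fintype.card (Win n I₀) ≤ n :=
    (Fintype.card_le_of_injective (Subtype.val : Win n I₀ → Fin n) Subtype.val_injective).trans_eq
      (Fintype.card_fin n)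
  have h2 : Fintype.card (Lft n B I₀) ≤ n * B :=
    (Fintype.card_le_of_injective (Subtype.val : Lft n B I₀ → Fin n × Fin B) Subtype.val_injective).trans_eq
      (by rw [Fintype.card_prod, Fintype.card_fin, Fintype.card_fin])
  have h3 : Fintype.card (S2 n B I₀) = Fintype.card (Win n I₀) + Fintype.card (Lft n B I₀) := Fintype.card_sum
  calc ∑ j : S2 n B I₀, Real.exp (-(a * bdist n s (p2 n B I₀ j))) ≤ ∑ _j : S2 n B I₀, (1 : ℝ) :=
        sum_le_sum fun j _ => Real.exp_le_one_iff.2 (neg_nonpos.2 (mul_nonneg ha.le (bdist_nonneg _ _)))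
    _ = Fintype.card (S2 n B I₀) := by simp
    _ ≤ (n : ℝ) + n * B := by rw [h3]; exact_mod_cast add_le_add h1 h2
    _ = n * (B + 1) := by ring

end ToyFrame

/-! ## §1 Zero records -/

section Zero

/-- the zero matrix has an h-free record with `r = c = 0` (any `κ`, any target class). [folklore] -/
theorem opLoc_zero {S : Type*} {U₁ U₂ E u v mu : Type*} [Fintype v] [DecidableEq U₂] (F : Frame S) (p₁ : U₁ → S)
    (p₂ : U₂ → S) (dE : E → E → ℝ) (ℓ : E → ℝ) (k κ : ℤ) (f : mu → u) (xr : mu → E) (xc : v → E) (br : mu → U₁)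
    (bc : v → U₂) : OpLoc F p₁ p₂ dE ℓ k ⟨0, κ, 0⟩ (0 : Matrix u v ℝ) f xr xc br bc where
  r_nonneg := le_refl _
  c_nonneg := le_refl _
  rng _ _ _ hT := (hT rfl).elim
  loc _ _ hT := (hT rfl).elim
  maj a J _ := by simp

/-- the zero matrix lies in every zone class `𝒵(k, 0)` (majorant `K = 0`). [folklore] -/
theorem opZon_zero {S : Type*} {u v U V : Type*} [Fintype v] [DecidableEq V] (F : Frame S) (bu : u → U)
    (bv : v → V) (pU : U → S) (pV : V → S) (k : ℤ) : OpZon F bu bv pU pV k 0 (0 : Matrix u v ℝ) :=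
  ⟨0, ⟨fun _ _ => le_refl _, fun _ _ => by simp⟩, fun _ _ => by simp, fun _ _ h => (h rfl).elim⟩

/-- the zero matrix lies in every class `𝒟(m, k, c)` of the toy frame, `0 ≤ c`. [folklore] -/
theorem opDec_zero_toy {n B : ℕ} {N : Finset (Fin n)} {hN : N.Nonempty} {δ₀ : ℝ} {u v U V : Type*} [Fintype v]
    [DecidableEq V] (bu : u → U) (bv : v → V) (pU : U → Fin n) (pV : V → Fin n) (m : ℕ) (k : ℤ) {c : ℝ}
    (hc : 0 ≤ c) : OpDec (toyFrame n B N hN δ₀) bu bv pU pV m k c (0 : Matrix u v ℝ) :=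
  ⟨0, ⟨fun _ _ => le_refl _, fun _ _ => by simp⟩, fun i j => by
    simp only [Matrix.zero_apply, abs_zero, toyFrame_sc]
    exact mul_nonneg (mul_nonneg hc (zpow_nonneg (Nat.cast_nonneg B) k)) (Real.exp_nonneg _)⟩

end Zero

/-! ## §2 The inverse identities of the toy's Q-type operators -/

section Inverses

variable {n B I₀ : ℕ}

/-- [folklore] -/
theorem Qp_nonneg (I : Fin n) (y : Fin n × Fin B) : 0 ≤ Qp n B I y := by
  unfold Qp; split_ifs <;> positivity

/-- [folklore] -/
theorem Qalt_nonneg (hB : 0 < B) (I : Fin n) (y : Fin n × Fin B) : 0 ≤ Qalt n B I₀ hB I y := by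
  by_cases hI : I.val < I₀
  · rw [Qalt_of_lt hB hI]; split_ifs <;> norm_num
  · rw [Qalt_of_not_lt hB hI]; exact Qp_nonneg I y

/-- **`W·Q′*₁ = 1`** for every non-negative `W` with unit block row sums `Σ_{y ∈ block J} |W(I, y)| = [J = I]`.
[folklore] -/
theorem mul_Qpt_eq_one {W : Matrix (Fin n) (Fin n × Fin B) ℝ} (hW0 : ∀ I y, 0 ≤ W I y)
    (hWr : ∀ I J, ∑ y ∈ univ.filter (fun y : Fin n × Fin B => y.1 = J), |W I y| = if J = I then 1 else 0) :
    W * Qpt n B = 1 := by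
  ext I J
  rw [Matrix.mul_apply, Matrix.one_apply]
  have h1 : ∀ y : Fin n × Fin B, W I y * Qpt n B y J = if y.1 = J then W I y else 0 := by
    intro y; unfold Qpt; split_ifs <;> simp
  have h2 : ∑ y ∈ univ.filter (fun y : Fin n × Fin B => y.1 = J), W I y =
      ∑ y ∈ univ.filter (fun y : Fin n × Fin B => y.1 = J), |W I y| :=
    sum_congr rfl fun y _ => (abs_of_nonneg (hW0 I y)).symm
  rw [sum_congr rfl fun y _ => h1 y, ← sum_filter, h2, hWr I J]
  by_cases h : I = J
  · rw [if_pos h.symm, if_pos h]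
  · rw [if_neg (fun h' => h h'.symm), if_neg h]

/-- support in the own block from the unit block row sums. [folklore] -/
theorem fst_eq_of_ne_zero {W : Matrix (Fin n) (Fin n × Fin B) ℝ}
    (hWr : ∀ I J, ∑ y ∈ univ.filter (fun y : Fin n × Fin B => y.1 = J), |W I y| = if J = I then 1 else 0)
    {I : Fin n} {y : Fin n × Fin B} (h : W I y ≠ 0) : y.1 = I := by
  by_contra hy
  have h1 := hWr I y.1
  rw [if_neg hy] at h1
  have h2 : |W I y| ≤ ∑ y' ∈ univ.filter (fun y' : Fin n × Fin B => y'.1 = y.1), |W I y'| :=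
    single_le_sum (f := fun y' => |W I y'|) (fun _ _ => abs_nonneg _) (mem_filter.2 ⟨mem_univ _, rfl⟩)
  rw [h1] at h2
  exact h (abs_eq_zero.1 (le_antisymm h2 (abs_nonneg _)))

/-- a window block and a left element never share a block index. [folklore] -/
theorem win_ne_lft (u : Win n I₀) (e : Lft n B I₀) : e.val.1 ≠ u.val := by
  intro h
  have hu := u.property
  have he := e.property
  rw [h] at he
  exact he hu

/-- **`Q2 W·Q′*₂ = 1` ON THE SECOND CARRIER** for every such `W`: window × window = the sequence-1 identity,
window × left and left × window VANISH (a left un-averaged site meets no window block), left × left = identity of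
the point evaluations. [folklore] -/
theorem Q2_mul_Q2t_eq_one {W : Matrix (Fin n) (Fin n × Fin B) ℝ} (hW0 : ∀ I y, 0 ≤ W I y)
    (hWr : ∀ I J, ∑ y ∈ univ.filter (fun y : Fin n × Fin B => y.1 = J), |W I y| = if J = I then 1 else 0) :
    Q2 n B I₀ W * Q2t n B I₀ = 1 := by
  have key : ∀ I J : Fin n, ∑ y, W I y * Qpt n B y J = if I = J then (1 : ℝ) else 0 := by
    intro I J
    have h := congrFun (congrFun (mul_Qpt_eq_one hW0 hWr) I) J
    rwa [Matrix.mul_apply, Matrix.one_apply] at h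
  ext J J'
  rw [Matrix.mul_apply, Matrix.one_apply]
  rcases J with u | e <;> rcases J' with u' | e'
  · simp only [Q2_inl, Q2t_inl]
    have h1 : ∑ y, W u.val y * (if y.1 = u'.val then (1 : ℝ) else 0) = ∑ y, W u.val y * Qpt n B y u'.val :=
      sum_congr rfl fun y _ => by unfold Qpt; rfl
    rw [h1, key]
    by_cases h : u = u'
    · subst h; simp
    · rw [if_neg (fun h' => h (Subtype.ext h')), if_neg (fun h' => h (Sum.inl_injective h'))]
  · simp only [Q2_inl, Q2t_inr, mul_ite, mul_one, mul_zero, Finset.sum_ite_eq', mem_univ, if_true]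
    rw [if_neg Sum.inl_ne_inr]
    by_contra h
    exact win_ne_lft u e' (fst_eq_of_ne_zero hWr h)
  · simp only [Q2_inr, Q2t_inl, ite_mul, one_mul, zero_mul, Finset.sum_ite_eq', mem_univ, if_true]
    rw [if_neg Sum.inr_ne_inl, if_neg (win_ne_lft u' e)]
  · simp only [Q2_inr, Q2t_inr, ite_mul, one_mul, zero_mul, Finset.sum_ite_eq', mem_univ, if_true]
    by_cases h : e = e'
    · subst h; simp
    · rw [if_neg (fun h' => h (Subtype.ext h')), if_neg (fun h' => h (Sum.inr_injective h'))]

/-- `Q′·Q′*₁ = 1`. [folklore] -/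
theorem Qp_mul_Qpt (hB : 0 < B) : Qp n B * Qpt n B = 1 := mul_Qpt_eq_one Qp_nonneg (Qp_rowsum hB)

/-- `Qalt·Q′*₁ = 1`. [folklore] -/
theorem Qalt_mul_Qpt (hB : 0 < B) : Qalt n B I₀ hB * Qpt n B = 1 :=
  mul_Qpt_eq_one (Qalt_nonneg hB) (Qalt_rowsum hB)

/-- `Q2 Q′·Q′*₂ = 1` on `S2`. [folklore] -/
theorem Q2Qp_mul_Q2t (hB : 0 < B) : Q2 n B I₀ (Qp n B) * Q2t n B I₀ = 1 :=
  Q2_mul_Q2t_eq_one Qp_nonneg (Qp_rowsum hB)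

/-- `Q2 Qalt·Q′*₂ = 1` on `S2`. [folklore] -/
theorem Q2Qalt_mul_Q2t (hB : 0 < B) : Q2 n B I₀ (Qalt n B I₀ hB) * Q2t n B I₀ = 1 :=
  Q2_mul_Q2t_eq_one (Qalt_nonneg hB) (Qalt_rowsum hB)

end Inverses

/-! ## §3 The toy two-sequence system -/

section System

variable {n B M I₀ : ℕ}

/-- **THE TOY TWO-SEQUENCE SYSTEM** (degenerate differential block): shared fine carriers sites = bonds =
`Fin n × Fin B`; coarse carriers `Fin n` (sequence 1) and `S2 = Win ⊕ Lft` (sequence 2); `χ = diag h`,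
`ψ = cutX val inl (h ∘ x_S)`; ∂ = ∂* = 0, Λ = Λ′ = 1, A = A′ = 0; Q₁ = Q′₁ = Q′, Q₂ = Q2 Q′, Q′₂ = Q2 Qalt, Q*₁ =
Q′*₁ = Qpt, Q*₂ = Q′*₂ = Q2t; G′ = G = C = 1 with the six inverse identities PROVED (§2).  OURS (typing + the
identities). [cite: Balaban1985BackgroundPropagators, (3.25)–(3.27) p.394–395 + (3.19) p.393 + p.412] -/
def toyX (n B M I₀ : ℕ) (hB : 0 < B) :
    TwoSeq (Fin n × Fin B) (Fin n × Fin B) (Fin n) (S2 n B I₀) (Fin n) (S2 n B I₀) where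
  χs := Matrix.diagonal (hcut n B M I₀)
  χb := Matrix.diagonal (hcut n B M I₀)
  ψS := cutX (Subtype.val : Win n I₀ → Fin n) (Sum.inl : Win n I₀ → S2 n B I₀) fun u => hcut n B M I₀ (xS hB u.val)
  ψB := cutX (Subtype.val : Win n I₀ → Fin n) (Sum.inl : Win n I₀ → S2 n B I₀) fun u => hcut n B M I₀ (xS hB u.val)
  D := 0
  Dt := 0
  Λ := 1
  Λ' := 1
  Q₁ := Qp n B
  Q₂ := Q2 n B I₀ (Qp n B)
  Qt₁ := Qpt n B
  Qt₂ := Q2t n B I₀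
  Q'₁ := Qp n B
  Q'₂ := Q2 n B I₀ (Qalt n B I₀ hB)
  Q't₁ := Qpt n B
  Q't₂ := Q2t n B I₀
  A₁ := 0
  A₂ := 0
  A'₁ := 0
  A'₂ := 0
  G'₁ := 1
  G'₂ := 1
  C₁ := 1
  C₂ := 1
  G₁ := 1
  G₂ := 1
  hG'₁ := by simp
  hG'₂ := by simp
  hC₁ := by simp only [Matrix.one_mul, Matrix.mul_one]; exact Qp_mul_Qpt hB
  hC₂ := by simp only [Matrix.mul_one]; exact Q2Qalt_mul_Q2t hB
  hG₁ := by simp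
  hG₂ := by simp

/-- the two scalar averagings of `toyX` DIFFER at the common window rows: at a window block `u` left of `I₀`
(`I₀ ≤ u + 2`, `u < I₀`) the row `Q′₁ u = Q′ u` has the entry `B⁻¹` and the row `Q′₂ (inl u) = Qalt u` the entry `1`
at the block's left end (`2 ≤ B`). [folklore] -/
theorem toyX_Q'_ne (hB : 0 < B) (hB2 : 2 ≤ B) (u : Win n I₀) (hu : u.val.val < I₀) :
    (toyX n B M I₀ hB).Q'₁ u.val (xS hB u.val) ≠ (toyX n B M I₀ hB).Q'₂ (Sum.inl u) (xS hB u.val) := by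
  show Qp n B u.val (xS hB u.val) ≠ Q2 n B I₀ (Qalt n B I₀ hB) (Sum.inl u) (xS hB u.val)
  rw [Q2_inl, Qalt_of_lt hB hu, if_pos rfl]
  have h3 : Qp n B u.val (xS hB u.val) = (B : ℝ)⁻¹ := by simp [Qp, xS]
  rw [h3]
  intro h
  have h5 : (B : ℝ) * (B : ℝ)⁻¹ = 1 := mul_inv_cancel₀ (by positivity)
  rw [h, mul_one] at h5
  have h6 : B = 1 := by exact_mod_cast h5
  omega

end System

/-! ## §4 The complete cut model on the toy -/

section Cut

variable {n B M I₀ : ℕ} {δ₀ : ℝ}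

/-- **THE FIRST INHABITED `CutModel`**: over `toyX` in the block frame with zone `rampZone`, frame sites `id` /
`p2`, sequence-1 block maps `Prod.fst` (sites, bonds), `id` (coarse), sequence-2 block maps `bs2` (sites, bonds,
2-tensors) and `id` (coarse), ∇ = 0 on the 2-tensor carrier `Fin n × Fin B`, positions `E = Fin n × Fin B`, windows
`Win`.  ALL 76 fields (29 data, 47 hypotheses) are discharged from gens 14–15 (`ramp_modulus`/`ramp_zone`/
`farS1`/`farS2`, `Qalt_agree`, `opLoc_Qp`/`opLoc_Qalt`/`opLoc_Q2`/`opLoc_Q2t`, `locQp1`/`locQ2t`), §1 (`opLoc_zero`,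
`opZon_zero`) and `tdef_one` (the Leibniz block vanishes identically).  OURS.
[cite: Balaban1985BackgroundPropagators, p.408 + p.412 + (3.100) p.413 + (3.102) p.414] -/
def toyCut (hB : 0 < B) (hM : 0 < M) (hI₀ : I₀ < n) (δ₀ : ℝ) :
    CutModel (toyFrame n B (rampZone n M I₀) (rampZone_nonempty hI₀) δ₀) (toyX n B M I₀ hB) id (p2 n B I₀)
      Prod.fst Prod.fst id id (bs2 n B I₀) (bs2 n B I₀) (bs2 n B I₀) id id
      (0 : Matrix (Fin n × Fin B) (Fin n × Fin B) ℝ) (Fin n × Fin B) (Win n I₀) (Win n I₀) where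
  dE := dE n B
  h := hcut n B M I₀
  ℓ := fun _ => (B : ℝ)
  ω₀ := 1 / M
  blk := Prod.fst
  xs := id
  xb := id
  xS₁ := xS hB
  xS₂ := xS2 n B I₀ hB
  xB₁ := xS hB
  xB₂ := xS2 n B I₀ hB
  fS₁ := Subtype.val
  fS₂ := Sum.inl
  fB₁ := Subtype.val
  fB₂ := Sum.inl
  oQ := ⟨1, 1, 1⟩
  oQt := ⟨1, 1, 1⟩
  oD := ⟨0, 0, 0⟩
  oDt := ⟨0, 0, 0⟩
  oA := ⟨0, 0, 0⟩
  oQ' := ⟨1, 1, 1⟩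
  oQ't := ⟨1, 1, 1⟩
  θL := 0
  Lm₁ := 0
  Lm₀ := 0
  Dm₁ := 0
  Dm₀ := 0
  Am₁ := 0
  Am₀ := 0
  hω₀ := by positivity
  fS₁_inj := Subtype.val_injective
  fS₂_inj := Sum.inl_injective
  fB₁_inj := Subtype.val_injective
  fB₂_inj := Sum.inl_injective
  xfS _ := rfl
  xfB _ := rfl
  blk_s _ := rfl
  blk_b _ := rfl
  blk_S _ := rfl
  blk_B _ := rfl
  hχs := rfl
  hχb := rfl
  hψS := rfl
  hψB := rfl
  modulus := ramp_modulus (N := rampZone n M I₀) (hN := rampZone_nonempty hI₀) (δ₀ := δ₀) hB hM _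
  zone := ramp_zone (δ₀ := δ₀) hB hM (rampZone_nonempty hI₀)
  farS₁ := farS1 hB hM
  farS₂ := farS2 hB hM
  farB₁ := farS1 hB hM
  farB₂ := farS2 hB hM
  agQ _ _ _ := rfl
  agQt _ _ _ := rfl
  agA _ _ _ := rfl
  agQ' u v hh := Qalt_agree hB hM u.val v hh
  agQ't _ _ _ := rfl
  lQ := opLoc_toy (opLoc_Q2 hB (opLoc_Qp hB))
  lQt := opLoc_toy (opLoc_Q2t hB)
  lD := opLoc_zero _ _ _ _ _ _ _ _ _ _ _ _
  lDt := opLoc_zero _ _ _ _ _ _ _ _ _ _ _ _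
  lA := opLoc_zero _ _ _ _ _ _ _ _ _ _ _ _
  lQ' := opLoc_toy (opLoc_Q2 hB (opLoc_Qalt hB))
  lQ't := opLoc_toy (opLoc_Q2t hB)
  locQ₁ := locQp1 hB
  locQ'₁ := locQp1 hB
  locQt₂ := locQ2t hB
  locQ't₂ := locQ2t hB
  hθL := le_refl _
  hΛ := by
    show tdef (Matrix.diagonal (hcut n B M I₀)) (Matrix.diagonal (hcut n B M I₀))
        (1 : Matrix (Fin n × Fin B) (Fin n × Fin B) ℝ) 1 = 0 * 0 + 0
    rw [B9SectCDiff.tdef_one, Matrix.zero_mul, add_zero]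
  zLm₁ := opZon_zero _ _ _ _ _ _
  zLm₀ := opZon_zero _ _ _ _ _ _
  hM := by
    show (0 : Matrix (Fin n × Fin B) (Fin n × Fin B) ℝ) * _ = 0 * 0 + 0
    rw [Matrix.zero_mul, Matrix.zero_mul, add_zero]
  zDm₁ := opZon_zero _ _ _ _ _ _
  zDm₀ := opZon_zero _ _ _ _ _ _
  hA := by
    show tdef (Matrix.diagonal (hcut n B M I₀)) (Matrix.diagonal (hcut n B M I₀))
        ((0 : Matrix (Fin n × Fin B) (Fin n × Fin B) ℝ) * 0 + 1 + 0)
        ((0 : Matrix (Fin n × Fin B) (Fin n × Fin B) ℝ) * 0 + 1 + 0) = 0 * 0 + 0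
    simp only [Matrix.zero_mul, zero_add, add_zero, B9SectCDiff.tdef_one]
  zAm₁ := opZon_zero _ _ _ _ _ _
  zAm₀ := opZon_zero _ _ _ _ _ _

/-- **the common (L) constant of the toy cut model is `4/M`**: `θ = ω₀·Σ_T r_T c_T + θL` with `ω₀ = 1/M`, four
Q-type records with `r = c = 1`, three zero records, `θL = 0`. OURS. [cite: Balaban1985BackgroundPropagators, p.414] -/
theorem toyCut_theta (hB : 0 < B) (hM : 0 < M) (hI₀ : I₀ < n) (δ₀ : ℝ) :
    (toyCut hB hM hI₀ δ₀).theta = 4 / M := by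
  show (1 / (M : ℝ)) * (1 * 1 + 1 * 1 + 0 * 0 + 0 * 0 + 0 * 0 + 1 * 1 + 1 * 1) + 0 = 4 / M
  ring

/-- [folklore] -/
@[simp] theorem toyCut_h (hB : 0 < B) (hM : 0 < M) (hI₀ : I₀ < n) (δ₀ : ℝ) :
    (toyCut hB hM hI₀ δ₀).h = hcut n B M I₀ := rfl

/-- [folklore] -/
@[simp] theorem toyCut_ω₀ (hB : 0 < B) (hM : 0 < M) (hI₀ : I₀ < n) (δ₀ : ℝ) :
    (toyCut hB hM hI₀ δ₀).ω₀ = 1 / M := rfl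

/-- [folklore] -/
@[simp] theorem toyCut_θL (hB : 0 < B) (hM : 0 < M) (hI₀ : I₀ < n) (δ₀ : ℝ) :
    (toyCut hB hM hI₀ δ₀).θL = 0 := rfl

/-- the cutoff of the toy cut model is NOT constant (it takes the values 0 and 1 when the ramp fits: `I₀ + M < n`).
[folklore] -/
theorem toyCut_h_nonconst (hB : 0 < B) (hM : 0 < M) (hI₀ : I₀ < n) (δ₀ : ℝ) (hfit : I₀ + M < n) (hI : 0 < I₀) :
    ∃ e e', (toyCut hB hM hI₀ δ₀).h e = 0 ∧ (toyCut hB hM hI₀ δ₀).h e' = 1 := by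
  refine ⟨xS hB ⟨0, by omega⟩, xS hB ⟨I₀ + M, hfit⟩, ?_, ?_⟩
  · exact hcut_xS_eq_zero_of_le hB hM (Nat.zero_le _)
  · show hcut n B M I₀ (xS hB ⟨I₀ + M, hfit⟩) = 1
    unfold hcut
    rw [pos_xS]
    refine ramp_eq_one_of_ge hB hM ?_
    push_cast
    nlinarith [show (0 : ℝ) < B by exact_mod_cast hB, show (0 : ℝ) < M by exact_mod_cast hM]

end Cut

/-! ## §5 The first inhabited (L) bundle -/

section LBundle

variable {n B M I₀ : ℕ} {δ₀ : ℝ}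

/-- **THE FIRST INHABITED `LDat`**: the (L) bundle of THEOREM D's hypothesis record for the toy two-sequence system,
at `θ = toyCut.theta = 4/M`, by gen 13's `CutModel.toLDat` (seven `opZon_of_geom` + `opZon_mono`; Leibniz block
inherited).  OURS. [cite: Balaban1985BackgroundPropagators, (3.100) p.413 + p.414] -/
def toyLDat (hB : 0 < B) (hM : 0 < M) (hI₀ : I₀ < n) (hδ₀ : 0 < δ₀) :
    LDat (toyFrame n B (rampZone n M I₀) (rampZone_nonempty hI₀) δ₀) (toyX n B M I₀ hB) id (p2 n B I₀)
      Prod.fst Prod.fst id id (bs2 n B I₀) (bs2 n B I₀) (bs2 n B I₀) id id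
      (0 : Matrix (Fin n × Fin B) (Fin n × Fin B) ℝ) (toyCut hB hM hI₀ δ₀).theta :=
  (toyCut hB hM hI₀ δ₀).toLDat (toyFrame_valid hB _ hδ₀)

/-- **(L) AT `θ = 4/M` IS INHABITED** on the toy. OURS. [cite: Balaban1985BackgroundPropagators, p.414] -/
theorem ldat_nonempty (hB : 0 < B) (hM : 0 < M) (hI₀ : I₀ < n) (hδ₀ : 0 < δ₀) :
    Nonempty (LDat (toyFrame n B (rampZone n M I₀) (rampZone_nonempty hI₀) δ₀) (toyX n B M I₀ hB) id (p2 n B I₀)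
      Prod.fst Prod.fst id id (bs2 n B I₀) (bs2 n B I₀) (bs2 n B I₀) id id
      (0 : Matrix (Fin n × Fin B) (Fin n × Fin B) ℝ) (4 / M)) := by
  rw [← toyCut_theta hB hM hI₀ δ₀]
  exact ⟨toyLDat hB hM hI₀ hδ₀⟩

/-- unfolded: the zone field `zQ'` of the inhabited bundle — `𝔇(Q′) = ψ·Q′₂ − Q′₁·χ ∈ 𝒵(0, 4/M)` for the toy
system's OWN defect `toyX.dQ'` (sequence 1 on `Fin n`, sequence 2 on `S2`). OURS.
[cite: Balaban1985BackgroundPropagators, (3.102) p.414] -/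
theorem toyX_dQ'_opZon (hB : 0 < B) (hM : 0 < M) (hI₀ : I₀ < n) (hδ₀ : 0 < δ₀) :
    OpZon (toyFrame n B (rampZone n M I₀) (rampZone_nonempty hI₀) δ₀) id (bs2 n B I₀) id (p2 n B I₀) 0
      (toyCut hB hM hI₀ δ₀).theta (toyX n B M I₀ hB).dQ' :=
  (toyLDat hB hM hI₀ hδ₀).zQ'

end LBundle

/-! ## §6 (M) on the toy: the one-sequence factors in the classes `𝒟(0, k, B⁴)` -/

section MSide

variable {n B M I₀ : ℕ} {N : Finset (Fin n)} {hN : N.Nonempty} {δ₀ : ℝ}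

/-- the identity matrix has the identity as block majorant (equal row/column block maps). [folklore] -/
theorem blkMaj_one {u U : Type*} [Fintype u] [DecidableEq u] [DecidableEq U] (bu : u → U) :
    BlkMaj bu bu (1 : Matrix u u ℝ) (1 : Matrix U U ℝ) where
  nonneg I J := by rw [Matrix.one_apply]; split_ifs <;> norm_num
  le x J := by
    have h1 : ∀ x', |(1 : Matrix u u ℝ) x x'| = if x = x' then 1 else 0 := fun x' => by
      rw [Matrix.one_apply]; split_ifs <;> simp
    simp only [h1]
    rw [Matrix.one_apply]
    by_cases h : bu x = J
    · rw [if_pos h]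
      calc ∑ x' ∈ univ.filter (fun x' => bu x' = J), (if x = x' then (1 : ℝ) else 0)
          ≤ ∑ x' ∈ univ, (if x = x' then (1 : ℝ) else 0) :=
            sum_le_sum_of_subset_of_nonneg (filter_subset _ _) fun _ _ _ => by split_ifs <;> norm_num
        _ = 1 := by rw [Finset.sum_ite_eq, if_pos (mem_univ _)]
    · rw [if_neg h]
      refine le_of_eq (sum_eq_zero fun x' hx' => ?_)
      rw [mem_filter] at hx'
      rw [if_neg]
      rintro rfl
      exact h hx'.2

/-- the identity majorant is in the weighted class of the toy frame as soon as `1 ≤ c·B^k`. [folklore] -/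
theorem wdec_one_toy {U : Type*} [DecidableEq U] (p : U → Fin n) (k : ℤ) {c : ℝ} (hc0 : 0 ≤ c)
    (hc : 1 ≤ c * (B : ℝ) ^ k) :
    WDec (toyFrame n B N hN δ₀).ρ p p (fun a => (toyFrame n B N hN δ₀).sc a ^ k) c
      ((toyFrame n B N hN δ₀).rate 0) (1 : Matrix U U ℝ) := by
  intro I J
  simp only [toyFrame_ρ, toyFrame_sc, Frame.rate_zero, toyFrame_δ₀, Matrix.one_apply]
  by_cases h : I = J
  · subst h
    rw [if_pos rfl, abs_one, bdist_self, mul_zero, neg_zero, Real.exp_zero, mul_one]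
    exact hc
  · rw [if_neg h, abs_zero]
    exact mul_nonneg (mul_nonneg hc0 (zpow_nonneg (Nat.cast_nonneg B) k)) (Real.exp_nonneg _)

/-- `1 ∈ 𝒟(0, k, c)` on the toy frame for `1 ≤ c·B^k`. [folklore] -/
theorem opDec_one_toy {u U : Type*} [Fintype u] [DecidableEq u] [DecidableEq U] (bu : u → U) (p : U → Fin n)
    (k : ℤ) {c : ℝ} (hc0 : 0 ≤ c) (hc : 1 ≤ c * (B : ℝ) ^ k) :
    OpDec (toyFrame n B N hN δ₀) bu bu p p 0 k c (1 : Matrix u u ℝ) :=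
  ⟨1, blkMaj_one bu, wdec_one_toy p k hc0 hc⟩

/-- an averaging with unit block row sums in its own block has the identity as block majorant. [folklore] -/
theorem blkMaj_of_rowsum {W : Matrix (Fin n) (Fin n × Fin B) ℝ}
    (hWr : ∀ I J, ∑ y ∈ univ.filter (fun y : Fin n × Fin B => y.1 = J), |W I y| = if J = I then 1 else 0) :
    BlkMaj id Prod.fst W (1 : Matrix (Fin n) (Fin n) ℝ) where
  nonneg I J := by rw [Matrix.one_apply]; split_ifs <;> norm_num
  le x J := by
    rw [hWr x J, id, Matrix.one_apply]
    by_cases h : x = J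
    · subst h; simp
    · rw [if_neg (Ne.symm h), if_neg h]

/-- `Q′, Qalt ∈ 𝒟(0, 0, c)`, `1 ≤ c`. [folklore] -/
theorem opDec_of_rowsum {W : Matrix (Fin n) (Fin n × Fin B) ℝ}
    (hWr : ∀ I J, ∑ y ∈ univ.filter (fun y : Fin n × Fin B => y.1 = J), |W I y| = if J = I then 1 else 0)
    {c : ℝ} (hc : 1 ≤ c) : OpDec (toyFrame n B N hN δ₀) id Prod.fst id id 0 0 c W :=
  ⟨1, blkMaj_of_rowsum hWr, wdec_one_toy id 0 (by linarith) (by rwa [zpow_zero, mul_one])⟩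

/-- the adjoint-type `Q′*₁` (row blocks `Prod.fst`, columns their own blocks) has the identity majorant.
[folklore] -/
theorem blkMaj_Qpt : BlkMaj Prod.fst id (Qpt n B) (1 : Matrix (Fin n) (Fin n) ℝ) where
  nonneg I J := by rw [Matrix.one_apply]; split_ifs <;> norm_num
  le a J := by
    have hf : univ.filter (fun x' : Fin n => id x' = J) = {J} := by ext x'; simp
    rw [hf, sum_singleton, Matrix.one_apply]
    unfold Qpt
    split_ifs <;> simp

/-- `Q′*₁ ∈ 𝒟(0, 0, c)`, `1 ≤ c`. [folklore] -/
theorem opDec_Qpt {c : ℝ} (hc : 1 ≤ c) : OpDec (toyFrame n B N hN δ₀) Prod.fst id id id 0 0 c (Qpt n B) :=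
  ⟨1, blkMaj_Qpt, wdec_one_toy id 0 (by linarith) (by rwa [zpow_zero, mul_one])⟩

/-- the adjoint-type `Q′*₂` (row blocks `bs2`, columns their own coarse elements) has the identity majorant on `S2`.
[folklore] -/
theorem blkMaj_Q2t : BlkMaj (bs2 n B I₀) id (Q2t n B I₀) (1 : Matrix (S2 n B I₀) (S2 n B I₀) ℝ) where
  nonneg I J := by rw [Matrix.one_apply]; split_ifs <;> norm_num
  le a J := by
    have hf : univ.filter (fun x' : S2 n B I₀ => id x' = J) = {J} := by ext x'; simp
    rw [hf, sum_singleton, Matrix.one_apply]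
    rcases J with u | e
    · rw [Q2t_inl]
      by_cases h : a.1 = u.val
      · rw [if_pos h, if_pos (bs2_eq_inl_iff.2 h), abs_one]
      · rw [if_neg h, if_neg (fun h' => h (bs2_eq_inl_iff.1 h')), abs_zero]
    · rw [Q2t_inr]
      by_cases h : a = e.val
      · rw [if_pos h, if_pos (bs2_eq_inr_iff.2 h), abs_one]
      · rw [if_neg h, if_neg (fun h' => h (bs2_eq_inr_iff.1 h')), abs_zero]

/-- `Q′*₂ ∈ 𝒟(0, 0, c)` on `S2`, `1 ≤ c`. [folklore] -/
theorem opDec_Q2t {c : ℝ} (hc : 1 ≤ c) :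
    OpDec (toyFrame n B N hN δ₀) (bs2 n B I₀) id (p2 n B I₀) (p2 n B I₀) 0 0 c (Q2t n B I₀) :=
  ⟨1, blkMaj_Q2t, wdec_one_toy (p2 n B I₀) 0 (by linarith) (by rwa [zpow_zero, mul_one])⟩

/-- the sequence-2 averaging `Q2 W` (rows = coarse elements of `S2`, column blocks `bs2`) has the identity majorant:
window rows have unit sums in their own window block and vanish on the left singletons, left rows are point
evaluations in their own singleton. [folklore] -/
theorem blkMaj_Q2 {W : Matrix (Fin n) (Fin n × Fin B) ℝ}
    (hWr : ∀ I J, ∑ y ∈ univ.filter (fun y : Fin n × Fin B => y.1 = J), |W I y| = if J = I then 1 else 0) :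
    BlkMaj id (bs2 n B I₀) (Q2 n B I₀ W) (1 : Matrix (S2 n B I₀) (S2 n B I₀) ℝ) where
  nonneg I J := by rw [Matrix.one_apply]; split_ifs <;> norm_num
  le J J' := by
    rw [id, Matrix.one_apply]
    rcases J with u | e <;> rcases J' with u' | e'
    · rw [filter_bs2_inl]
      simp only [Q2_inl]
      rw [hWr u.val u'.val]
      by_cases h : u = u'
      · subst h; simp
      · rw [if_neg (fun h' => h (Subtype.ext h'.symm)), if_neg (fun h' => h (Sum.inl_injective h'))]
    · rw [filter_bs2_inr, sum_singleton, Q2_inl, if_neg Sum.inl_ne_inr]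
      refine le_of_eq (abs_eq_zero.2 ?_)
      by_contra h
      exact win_ne_lft u e' (fst_eq_of_ne_zero hWr h)
    · rw [filter_bs2_inl, if_neg Sum.inr_ne_inl]
      refine le_of_eq (sum_eq_zero fun y hy => ?_)
      rw [mem_filter] at hy
      rw [Q2_inr, if_neg, abs_zero]
      rintro rfl
      exact win_ne_lft u' e hy.2
    · rw [filter_bs2_inr, sum_singleton, Q2_inr]
      by_cases h : e = e'
      · subst h; simp
      · rw [if_neg (fun h' => h (Subtype.ext h'.symm)), if_neg (fun h' => h (Sum.inr_injective h')), abs_zero]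

/-- `Q2 W ∈ 𝒟(0, 0, c)` on `S2`, `1 ≤ c`. [folklore] -/
theorem opDec_Q2 {W : Matrix (Fin n) (Fin n × Fin B) ℝ}
    (hWr : ∀ I J, ∑ y ∈ univ.filter (fun y : Fin n × Fin B => y.1 = J), |W I y| = if J = I then 1 else 0)
    {c : ℝ} (hc : 1 ≤ c) :
    OpDec (toyFrame n B N hN δ₀) id (bs2 n B I₀) (p2 n B I₀) (p2 n B I₀) 0 0 c (Q2 n B I₀ W) :=
  ⟨1, blkMaj_Q2 hWr, wdec_one_toy (p2 n B I₀) 0 (by linarith) (by rwa [zpow_zero, mul_one])⟩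

/-- the three weight inequalities of the toy's (M) constant `c = B⁴`. [folklore] -/
theorem B4_weights (hB : 0 < B) :
    (1 : ℝ) ≤ (B : ℝ) ^ 4 ∧ 1 ≤ (B : ℝ) ^ 4 * (B : ℝ) ^ (2 : ℤ) ∧ 1 ≤ (B : ℝ) ^ 4 * (B : ℝ) ^ (-4 : ℤ) := by
  have h1 : (1 : ℝ) ≤ B := by exact_mod_cast hB
  have h4 : (1 : ℝ) ≤ (B : ℝ) ^ 4 := one_le_pow₀ h1
  refine ⟨h4, ?_, ?_⟩
  · rw [show ((B : ℝ) ^ (2 : ℤ)) = (B : ℝ) ^ 2 from zpow_ofNat _ 2]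
    nlinarith [one_le_pow₀ (n := 2) h1]
  · rw [zpow_neg, show ((B : ℝ) ^ (4 : ℤ)) = (B : ℝ) ^ 4 from zpow_ofNat _ 4,
      mul_inv_cancel₀ (pow_ne_zero 4 (by positivity))]

/-- **(M) OF SEQUENCE 1 on the toy at `c = B⁴`**: `Q′ ∈ 𝒟(0,0)`, `G = 1 ∈ 𝒟(0,2)`, `∂G′ = 0`, `Q′*₁ ∈ 𝒟(0,0)`,
`C = 1 ∈ 𝒟(0,−4)` (this fixes `c = B⁴`), `Q′ ∈ 𝒟(0,0)`, `G′ = 1 ∈ 𝒟(0,2)`.  OURS.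
[cite: Balaban1985BackgroundPropagators, (3.42) + (3.48) pp.397–398] -/
theorem toyMOne (hB : 0 < B) (hI₀ : I₀ < n) (δ₀ : ℝ) :
    MOne (toyFrame n B (rampZone n M I₀) (rampZone_nonempty hI₀) δ₀) (toyX n B M I₀ hB) id Prod.fst Prod.fst id
      id ((B : ℝ) ^ 4) where
  mQ := opDec_of_rowsum (Qp_rowsum hB) (B4_weights hB).1
  mG := opDec_one_toy Prod.fst id 2 (by positivity) (B4_weights hB).2.1
  mDG' := by
    show OpDec _ _ _ _ _ 0 1 _ ((0 : Matrix (Fin n × Fin B) (Fin n × Fin B) ℝ) * 1)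
    rw [Matrix.zero_mul]
    exact opDec_zero_toy _ _ _ _ 0 1 (by positivity)
  mQ't := opDec_Qpt (B4_weights hB).1
  mC := opDec_one_toy id id (-4) (by positivity) (B4_weights hB).2.2
  mQ' := opDec_of_rowsum (Qp_rowsum hB) (B4_weights hB).1
  mG' := opDec_one_toy Prod.fst id 2 (by positivity) (B4_weights hB).2.1

/-- **(M) OF SEQUENCE 2 on the toy at `c = B⁴`** (with `∇ = 0`): `G = 1`, `Q*₂ = Q2t`, `∂*G = 0`, `∇G = 0`,
`G′ = 1`, `∂G′ = 0`, `Q′*₂ = Q2t`, `C = 1`, `Q′₂ = Q2 Qalt`.  OURS.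
[cite: Balaban1985BackgroundPropagators, (3.42) + (3.48) + Thm 3.3 pp.397–399] -/
theorem toyMTwo (hB : 0 < B) (hI₀ : I₀ < n) (δ₀ : ℝ) :
    MTwo (toyFrame n B (rampZone n M I₀) (rampZone_nonempty hI₀) δ₀) (toyX n B M I₀ hB) (p2 n B I₀) (bs2 n B I₀)
      (bs2 n B I₀) (bs2 n B I₀) id id (0 : Matrix (Fin n × Fin B) (Fin n × Fin B) ℝ) ((B : ℝ) ^ 4) where
  mG := opDec_one_toy (bs2 n B I₀) (p2 n B I₀) 2 (by positivity) (B4_weights hB).2.1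
  mQt := opDec_Q2t (B4_weights hB).1
  mDtG := by
    show OpDec _ _ _ _ _ 0 1 _ ((0 : Matrix (Fin n × Fin B) (Fin n × Fin B) ℝ) * 1)
    rw [Matrix.zero_mul]
    exact opDec_zero_toy _ _ _ _ 0 1 (by positivity)
  mDvG := by
    rw [Matrix.zero_mul]
    exact opDec_zero_toy _ _ _ _ 0 1 (by positivity)
  mG' := opDec_one_toy (bs2 n B I₀) (p2 n B I₀) 2 (by positivity) (B4_weights hB).2.1
  mDG' := by
    show OpDec _ _ _ _ _ 0 1 _ ((0 : Matrix (Fin n × Fin B) (Fin n × Fin B) ℝ) * 1)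
    rw [Matrix.zero_mul]
    exact opDec_zero_toy _ _ _ _ 0 1 (by positivity)
  mQ't := opDec_Q2t (B4_weights hB).1
  mC := opDec_one_toy id (p2 n B I₀) (-4) (by positivity) (B4_weights hB).2.2
  mQ' := opDec_Q2 (Qalt_rowsum hB) (B4_weights hB).1

end MSide

/-! ## §7 (P) and the first inhabited `EstHyp`: THEOREM D's pipeline run end to end on the toy -/

section EstHypSide

variable {n B M I₀ : ℕ} {δ₀ : ℝ}

/-- **THE FIRST INHABITED `EstHyp`** (THEOREM D's 40-field hypothesis record): (M) per sequence at `c = B⁴`, (L) from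
the cut model at `θ = 4/M`, (P) the two profiles of the toy frame, assembled by gen 12's `assemble`.  OURS.
[cite: Balaban1985BackgroundPropagators, (3.97) p.412] -/
def toyEstHyp (hB : 0 < B) (hM : 0 < M) (hI₀ : I₀ < n) (hδ₀ : 0 < δ₀) :
    EstHyp (toyFrame n B (rampZone n M I₀) (rampZone_nonempty hI₀) δ₀) (toyX n B M I₀ hB) (Fin n × Fin B) (Fin n)
      (S2 n B I₀) :=
  assemble (toyFrame_valid hB _ hδ₀) (toyMOne hB hI₀ δ₀) (toyMTwo hB hI₀ δ₀) (toyLDat hB hM hI₀ hδ₀)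
    (by positivity) (by positivity) (by rw [toyCut_theta]; positivity) toyFrame_profile₁ toyFrame_profile₂

/-- [folklore] -/
theorem estHyp_nonempty (hB : 0 < B) (hM : 0 < M) (hI₀ : I₀ < n) (hδ₀ : 0 < δ₀) :
    Nonempty (EstHyp (toyFrame n B (rampZone n M I₀) (rampZone_nonempty hI₀) δ₀) (toyX n B M I₀ hB)
      (Fin n × Fin B) (Fin n) (S2 n B I₀)) :=
  ⟨toyEstHyp hB hM hI₀ hδ₀⟩

/-- the assembled common (M) constant is `max 1 (max B⁴ B⁴) = B⁴`. [folklore] -/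
theorem toyEstHyp_c (hB : 0 < B) (hM : 0 < M) (hI₀ : I₀ < n) (hδ₀ : 0 < δ₀) :
    (toyEstHyp hB hM hI₀ hδ₀).c = (B : ℝ) ^ 4 := by
  show max 1 (max ((B : ℝ) ^ 4) ((B : ℝ) ^ 4)) = (B : ℝ) ^ 4
  rw [max_self, max_eq_right (B4_weights hB).1]

/-- the assembled (L) constant is `4/M`. [folklore] -/
theorem toyEstHyp_θ (hB : 0 < B) (hM : 0 < M) (hI₀ : I₀ < n) (hδ₀ : 0 < δ₀) :
    (toyEstHyp hB hM hI₀ hδ₀).θ = 4 / M := by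
  show (toyCut hB hM hI₀ δ₀).theta = 4 / M
  exact toyCut_theta hB hM hI₀ δ₀

/-- **THEOREM D'S CONCLUSION ON THE TOY** (the cell's `core_diff_entry_of_parts` instantiated): at two window blocks
`u, u′` where the cutoff is full (`h(x_S u) = h(x_S u′) = 1`) the difference of the two minimal-propagator-type
operators `T₁ = Q₁G₁Q*₁` (on `Fin n`) and `T₂ = Q₂G₂Q*₂` (on `S2`) obeys the (1.12)-shaped bound with constant
`22·(4/M)·(B⁴·1·n(B+1))¹⁵`, scale power 2 and the depths of both blocks.  (Both operators are identities here, so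
the left side is 0: the content is that every hypothesis of the pipeline was DISCHARGED, not the inequality.)  OURS.
[cite: Balaban1985BackgroundPropagators, (3.97) p.412] -/
theorem toy_core_diff_entry (hB : 0 < B) (hM : 0 < M) (hI₀ : I₀ < n) (hδ₀ : 0 < δ₀) {u u' : Win n I₀}
    (hu : hcut n B M I₀ (xS hB u.val) = 1) (hu' : hcut n B M I₀ (xS hB u'.val) = 1) :
    |(toyX n B M I₀ hB).T₁ u.val u'.val - (toyX n B M I₀ hB).T₂ (Sum.inl u) (Sum.inl u')| ≤
      22 * (toyCut hB hM hI₀ δ₀).theta * (max 1 (max ((B : ℝ) ^ 4) ((B : ℝ) ^ 4)) *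
        (toyFrame n B (rampZone n M I₀) (rampZone_nonempty hI₀) δ₀).Λ *
        (toyFrame n B (rampZone n M I₀) (rampZone_nonempty hI₀) δ₀).K
          (toyFrame n B (rampZone n M I₀) (rampZone_nonempty hI₀) δ₀).u) ^ 15 *
      (toyFrame n B (rampZone n M I₀) (rampZone_nonempty hI₀) δ₀).sc u.val ^ (2 : ℤ) *
      Real.exp (-((toyFrame n B (rampZone n M I₀) (rampZone_nonempty hI₀) δ₀).σ *
        ((toyFrame n B (rampZone n M I₀) (rampZone_nonempty hI₀) δ₀).ρ u.val u'.val +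
          (toyFrame n B (rampZone n M I₀) (rampZone_nonempty hI₀) δ₀).β u.val +
          (toyFrame n B (rampZone n M I₀) (rampZone_nonempty hI₀) δ₀).β u'.val))) :=
  core_diff_entry_of_parts (toyFrame_valid hB _ hδ₀) (toyMOne hB hI₀ δ₀) (toyMTwo hB hI₀ δ₀)
    (toyLDat hB hM hI₀ hδ₀) (by positivity) (by positivity) (by rw [toyCut_theta]; positivity)
    toyFrame_profile₁ toyFrame_profile₂ Subtype.val_injective Sum.inl_injective
    (ψ := fun w : Win n I₀ => hcut n B M I₀ (xS hB w.val)) rfl hu hu'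

/-- … and its left side VANISHES identically (`T₁ = 1` on `Fin n`, `T₂ = 1` on `S2`). [folklore] -/
theorem toy_T_diff_eq_zero (hB : 0 < B) (u u' : Win n I₀) :
    (toyX n B M I₀ hB).T₁ u.val u'.val - (toyX n B M I₀ hB).T₂ (Sum.inl u) (Sum.inl u') = 0 := by
  have h1 : (toyX n B M I₀ hB).T₁ = 1 := by
    show Qp n B * 1 * Qpt n B = 1
    rw [Matrix.mul_one, Qp_mul_Qpt hB]
  have h2 : (toyX n B M I₀ hB).T₂ = 1 := by
    show Q2 n B I₀ (Qp n B) * 1 * Q2t n B I₀ = 1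
    rw [Matrix.mul_one, Q2Qp_mul_Q2t hB]
  rw [h1, h2, Matrix.one_apply, Matrix.one_apply]
  by_cases h : u = u'
  · subst h; simp
  · rw [if_neg (fun h' => h (Subtype.ext h')), if_neg (fun h' => h (Sum.inl_injective h')), sub_zero]

end EstHypSide

end

end Literature.MathematicalPhysics.QuantumFieldTheory.Balaban1983to89.B9SectCDiffCutModelToy3
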